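import Literature.Geometry.Kaehler.ComplexTorusDivisorClassesPushforward
import Literature.Geometry.Kaehler.ComplexTorusPicardNumberProduct
import Literature.Geometry.Kaehler.ComplexTorusHodgeClassesNonIsogenousPair
import Literature.LinearAlgebra.Alternating.GradedFormsRing
import HarnessLib

/-!
# The Künneth formula for Lefschetz classes: `D•(X₁ × X₂) = D•(X₁) ⊗ D•(X₂)` when the divisorial
# correspondences vanish (Milne 1999, Prop. 4.1 and Cor. 4.2, at torus level)

Layer `Literature/Geometry/Kaehler`, namespace `Literature.Geometry.Kaehler.ComplexTorus`; lane
`lit-hodgefound` (Track 2 foundations library), Layer A4, seat p08 (gen 10, row g10-#1). Sequel of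
`ComplexTorusGraphClassesLefschetz.lean` (`cross_mem_divisorClasses`: cross products of Lefschetz classes
are Lefschetz; `kunnethComponent_mem_divisorClasses`), of `ComplexTorusDivisorClassesRing.lean`
(`divisorClasses_le_of_forall_wedge_ofRealForm_mem`: `D•(X)` is the least graded `ℚ`-subspace of
`H^{2•}(X, ℂ)` containing `1` and stable under `· ∧ E`, `E ∈ NS(X)`), of
`ComplexTorusPicardNumberProduct.lean` (the block decomposition
`NS_ℚ(X₁ × X₂) ≅ NS_ℚ(X₁) ⊕ NS_ℚ(X₂) ⊕ nsCross Φ₁ Φ₂`, `nsCross_eq_homRat_dualPeriod`: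
`nsCross = Hom_ℚ(X₂, X̂₁)`, `nsCrossEquivHomRat`: `≅ Hom_ℚ(X₂, X₁)` for polarised `X₁`), of
`ComplexTorusHodgeClassesNonIsogenousPair.lean` (`twoForm_eq_compFst_add_compSnd_of_apply_inl_inr_eq_zero`:
a `2`-form with vanishing mixed part is `p₁^*ι₁^*γ + p₂^*ι₂^*γ`) and of
`ComplexTorusKunnethDecomposition.lean` (`eq_zero_of_sum_wedge_comp_fst_snd_eq_zero`: the Künneth cup
product is injective). Graded-ring bookkeeping in `GForm (E₁ × E₂) ℂ`
(`LinearAlgebra/Alternating/GradedFormsRing.lean`: `of_mul_of`, even classes are central).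

## Source, verbatim

J. S. Milne, *Lefschetz classes on abelian varieties*, Duke Math. J. 96 (1999) 639–675, §4 (held text
`paper:doi-10-1215-s0012-7094-99-09620-5`, p0020 L9–L41):

"**Proposition 4.1.** Let `X` and `Y` be smooth complete varieties over `Ω`. If the `ℚ`-space `DC(X, Y)`
of divisorial correspondences between `X` and `Y` is zero, then the map
`x ⊗ y ↦ p^*x · q^*y : D_hom(X)_k ⊗ D_hom(Y)_k → D_hom(X × Y)_k` is an isomorphism. Here `p` and `q` are
the projection maps from `X × Y` to `X` and `Y` respectively.
*Proof.* There is a canonical decomposition `NS(X × Y) ≅ NS(X) ⊕ NS(Y) ⊕ DC(X, Y)` which is compatible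
with the Künneth decomposition `H²(X × Y)(1) ≅ H²(X)(1) ⊕ H²(Y)(1) ⊕ H¹(X) ⊗ H¹(Y)(1)`. By assumption
`DC(X, Y) = 0`, and so […] The subalgebras of `H^{2*}(X × Y)(*) = H^{2*}(X)(*) ⊗ H^{2*}(Y)(*)` generated
respectively by `D¹_hom(X × Y)_k` and `D¹_hom(X)_k ⊕ D¹_hom(Y)_k` are `D_hom(X × Y)_k` and
`D_hom(X)_k ⊗ D_hom(Y)_k`, which are therefore equal.
**Corollary 4.2.** An isogeny `A → A₁^{r₁} × ⋯ × A_s^{r_s}` with the `A_i` simple and pairwise nonisogenous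
abelian varieties defines an isomorphism of `D_hom(A)_k` onto the subring
`D_hom(A₁^{r₁})_k ⊗ ⋯ ⊗ D_hom(A_s^{r_s})_k` […] *Proof.* In general, `DC(X, Y) ≅ Hom(A, B)`, where `A` is
the Albanese variety of `X` and `B` is the Picard variety of `Y`. Therefore, if `A` and `B` are abelian
varieties with `Hom(A, B) = 0`, then `DC(A, B) = 0` and the projection maps define an isomorphism
`D_hom(A)_k ⊗ D_hom(B)_k → D_hom(A × B)_k`. The general statement follows from this by induction."

## Torus-level rendering

Complex tori `X₁ = E₁/Φ₁(ℤ^{ι₁})`, `X₂ = E₂/Φ₂(ℤ^{ι₂})`, product `X₁ × X₂ = (E₁ × E₂)/(Λ₁ ⊕ Λ₂)`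
(`prodPeriod Φ₁ Φ₂`); `Dᵖ(X) = divisorClasses Φ p ⊆ H^{2p}(X, ℂ) = Alt^{2p}_ℝ(E; ℂ)` (row A4-15), the
`ℚ`-span of the wedge monomials of `NS(X)`; `p₁^* = · ∘ fst`, `p₂^* = · ∘ snd`, `· = ∧`. A divisorial
correspondence class is the Künneth `(1,1)`-part of a class `η ∈ NS(X₁ × X₂)`, the bilinear form
`(u, w) ↦ η((u, 0), (0, w))` on `E₁ × E₂`; in the matrix model of `ComplexTorusPicardNumberProduct` these
are the off-diagonal blocks `nsCross Φ₁ Φ₂ = Hom_ℚ(X₂, X̂₁)` of the Gram matrices of `NS_ℚ(X₁ × X₂)`.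
Milne's hypothesis "`DC(X₁, X₂) ⊗ ℚ = 0`" is therefore carried VERBATIM as
`∀ η, IsNSForm (prodPeriod Φ₁ Φ₂) η → ∀ u w, η ![(u, 0), (0, w)] = 0`, shown EQUIVALENT to
`nsCross Φ₁ Φ₂ = ⊥` (§1) and implied by `Hom_ℚ(X₂, X̂₁) = 0`, and by `Hom_ℚ(X₂, X₁) = 0` when `X₁` is an
abelian variety (Cor. 4.2's form). No polarisation is needed for the theorem itself.

## Contents (theorems only; no definition, no named fact, net debt 0)

* §0 graded-ring bookkeeping for cross products (any real normed spaces; private pointwise-linearity helpers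
  `add_compContinuousLinearMap_complex`, `smul_compContinuousLinearMap_complex`, `domDomCongr_complex_smul`),
  **`cross_wedge_compFst_two`** (`(p₁^*x ∧ p₂^*y) ∧ p₁^*e = p₁^*(x ∧ e) ∧ p₂^*y` for a `2`-form `e`, up to
  the degree casts: even classes are central in `GForm`) and `cross_wedge_compSnd_two`
  (`(p₁^*x ∧ p₂^*y) ∧ p₂^*e = p₁^*x ∧ p₂^*(y ∧ e)`).
* §1 divisorial correspondences: `apply_inl_inr_eq_dotProduct_toBlocks₁₂` (the mixed part
  `η((Φ₁x, 0), (0, Φ₂y)) = ᵗx G₁₂ y` is the off-diagonal block of the Gram matrix),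
  **`forall_apply_inl_inr_eq_zero_iff_nsCross_eq_bot`** (`DC(X₁, X₂) ⊗ ℚ = 0 ⟺ nsCross Φ₁ Φ₂ = ⊥`),
  `forall_apply_inl_inr_eq_zero_of_homRat_dualPeriod_eq_bot` (`Hom_ℚ(X₂, X̂₁) = 0 ⟹`),
  `forall_apply_inl_inr_eq_zero_of_homRat_eq_bot` / `IsAbelianVariety.forall_apply_inl_inr_eq_zero_of_homRat_eq_bot`
  (`X₁` carries a non-degenerate class of `NS_ℚ`, e.g. is an abelian variety, and `Hom_ℚ(X₂, X₁) = 0 ⟹`;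
  Cor. 4.2's hypothesis) and the mirrors `…_of_homRat_eq_bot'` (`X₂` polarised, `Hom_ℚ(X₁, X₂) = 0`).
* §2 codimension one: `IsNSForm.comp_inl`, `IsNSForm.comp_inr` (`ι₁^* NS(X₁ × X₂) ⊆ NS(X₁)`,
  `ι₂^* NS(X₁ × X₂) ⊆ NS(X₂)`), `ofRealForm_eq_compFst_add_compSnd` (`E = p₁^*ι₁^*E + p₂^*ι₂^*E` for
  `E ∈ NS(X₁ × X₂)` when `DC = 0`), `exists_eq_compFst_add_compSnd_of_mem_divisorClasses_one`
  (`D¹(X₁ × X₂) ⊆ p₁^*D¹(X₁) + p₂^*D¹(X₂)` when `DC = 0`).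
* §3 Prop. 4.1, surjectivity: `cross_mem_divisorClasses_of_eq` (the generators `p₁^*x ∧ p₂^*y`,
  `x ∈ Dᵃ(X₁)`, `y ∈ Dᵇ(X₂)`, read along any `2a + 2b = 2p`, lie in `Dᵖ(X₁ × X₂)` — unconditional, row
  Q605), `span_cross_le_divisorClasses_prod` (`(D•(X₁) ⊗ D•(X₂))ᵖ ⊆ Dᵖ(X₁ × X₂)` for every pair),
  `wedge_ofRealForm_mem_span_cross` (the span of the cross products is stable under `· ∧ E`,
  `E ∈ NS(X₁ × X₂)`, when `DC = 0`) and **`divisorClasses_prod_eq_span_cross`**: if `DC(X₁, X₂) ⊗ ℚ = 0`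
  then for every `p`, `Dᵖ(X₁ × X₂) = span_ℚ {p₁^*x ∧ p₂^*y : x ∈ Dᵃ(X₁), y ∈ Dᵇ(X₂), a + b = p}`;
  Hom-forms `divisorClasses_prod_eq_span_cross_of_nsCross_eq_bot`, `…_of_homRat_dualPeriod_eq_bot`,
  **`IsAbelianVariety.divisorClasses_prod_eq_span_cross_of_homRat_eq_bot`** (Cor. 4.2: `X₁` an abelian
  variety, `Hom_ℚ(X₂, X₁) = 0`) and its mirror `…'`.
* §4 Prop. 4.1, injectivity and the dimension count: (private `linearIndependent_sigma_of_proj`: families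
  separated by a system of projectors glue) **`linearIndependent_cross`** (for `ℂ`-linearly independent families
  `x_i ∈ Λᵐ(E₁)`, `y_j ∈ Λⁿ(E₂)` the cross products `p₁^*x_i ∧ p₂^*y_j` are `ℂ`-linearly independent —
  Künneth, Voisin Thm. 11.38), `linearIndependent_cross_of_eq`,
  `linearIndependent_cross_sigma` (all splittings `a + b = p` at once, via the Künneth projectors `K_{2b}`,
  row A4-43), `divisorClasses_le_rationalForms`, `finiteDimensional_divisorClasses`,
  `exists_basis_linearIndependent_complex` (a `ℚ`-basis of `W ⊆ Hᵏ(X, ℚ)` is `ℂ`-independent),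
  `exists_linearIndependent_cross_family` (the cross products of bases), **`sum_finrank_divisorClasses_mul_le`**
  (`Σ_{a+b=p} dim_ℚ Dᵃ(X₁) · dim_ℚ Dᵇ(X₂) ≤ dim_ℚ Dᵖ(X₁ × X₂)` for EVERY pair of tori: the map of
  Prop. 4.1 is always one-to-one) and **`finrank_divisorClasses_prod_eq_sum`** (`=` when
  `DC(X₁, X₂) ⊗ ℚ = 0`: `⊕_{a+b=p} Dᵃ(X₁) ⊗_ℚ Dᵇ(X₂) ≅ Dᵖ(X₁ × X₂)`), with the Hom-forms
  `…_of_nsCross_eq_bot`, `…_of_homRat_dualPeriod_eq_bot`,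
  `IsAbelianVariety.finrank_divisorClasses_prod_eq_sum_of_homRat_eq_bot` (Cor. 4.2) and its mirror `…'`.

* §5 validation on a NON-ISOGENOUS PAIR OF ELLIPTIC CURVES `E_τ × E_{τ'}` (`1, τ, τ', ττ'` linearly
  independent over `ℚ`): `forall_apply_inl_inr_eq_zero_ellipticPair` (`DC ⊗ ℚ = 0`), `finrank_divisorClasses_zero`
  (`dim D⁰(X) = 1`, any torus), `finrank_divisorClasses_ellipticPeriod` (`dim D•(E_τ) = (1, 1, 0, …)`) and
  **`finrank_divisorClasses_ellipticPair`**: `dim_ℚ Dᵖ(E_τ × E_{τ'}) = C(2, p) = (1, 2, 1, 0, …)`.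

Not here: the `r`-fold form of Cor. 4.2 (products `A₁^{r₁} × ⋯ × A_s^{r_s}`, "by induction") and its
transport along an isogeny (`ComplexTorusDivisorClassesIsogeny`: `D•` is an isogeny invariant) — both are
iterations of the binary statement proved here, by name.

## References

* [Milne1999LefschetzClasses] J. S. Milne, *Lefschetz classes on abelian varieties*, Duke Math. J. 96
  (1999), §4 Prop. 4.1 and Cor. 4.2 (held `paper:doi-10-1215-s0012-7094-99-09620-5`, p0020 L9–L41).
* [HulekLaface2019PicardNumbersAV] K. Hulek, R. Laface, *On the Picard numbers of abelian varieties*,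
  Ann. Sc. Norm. Super. Pisa (5) XIX (2019), §2.1 Prop. 2.2 (`NS(X₁ × X₂)` and `Hom(X₂, X̂₁)`).
* [Voisin2002] C. Voisin, *Hodge Theory and Complex Algebraic Geometry I* (2002), §11.3.3 Thm. 11.38
  (Künneth).
* [Lange2023AbelianVarietiesComplex] H. Lange, *Abelian Varieties over the Complex Numbers* (2023),
  §7.3.1 (`D•(X)`), §2.4.2 Prop. 2.4.12 (`NS_ℚ`).
-/

noncomputable section

open Module Finset
open scoped Matrix
open Literature.Analysis.Complex (oneForm₀)
open Literature.LinearAlgebra.Alternating (GForm)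
open Literature.NumberTheory.Transcendental (wedge_smul_left_complex wedge_smul_right_complex)

namespace Literature.Geometry.Kaehler

namespace ComplexTorus

/-! ## §0 Cross products in the graded ring of forms -/

section FormAlgebra

variable {E₁ E₂ : Type*} [NormedAddCommGroup E₁] [NormedSpace ℝ E₁] [NormedAddCommGroup E₂]
  [NormedSpace ℝ E₂]

/-- Pull-back is additive in the form. [folklore] -/
private theorem add_compContinuousLinearMap_complex {V W : Type*} [NormedAddCommGroup V] [NormedSpace ℝ V]
    [NormedAddCommGroup W] [NormedSpace ℝ W] {k : ℕ} (x x' : V [⋀^Fin k]→L[ℝ] ℂ) (f : W →L[ℝ] V) :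
    (x + x').compContinuousLinearMap f = x.compContinuousLinearMap f + x'.compContinuousLinearMap f := by
  ext v; rfl

/-- Pull-back commutes with complex scalars. [folklore] -/
private theorem smul_compContinuousLinearMap_complex {V W : Type*} [NormedAddCommGroup V] [NormedSpace ℝ V]
    [NormedAddCommGroup W] [NormedSpace ℝ W] {k : ℕ} (c : ℂ) (x : V [⋀^Fin k]→L[ℝ] ℂ) (f : W →L[ℝ] V) :
    (c • x).compContinuousLinearMap f = c • x.compContinuousLinearMap f := by
  ext v; rfl

/-- Reindexing commutes with complex scalars. [folklore] -/
private theorem domDomCongr_complex_smul {V : Type*} [NormedAddCommGroup V] [NormedSpace ℝ V] {k k' : ℕ}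
    (σ : Fin k ≃ Fin k') (c : ℂ) (x : V [⋀^Fin k]→L[ℝ] ℂ) :
    (c • x).domDomCongr σ = c • x.domDomCongr σ := by
  ext v; rfl

/-- **`(p₁^*x ∧ p₂^*y) ∧ p₁^*e = p₁^*(x ∧ e) ∧ p₂^*y` for a form `e` of even degree** (here degree `2`),
up to the reindexings of degrees: `p₁^*` is multiplicative and even classes are central in the exterior
algebra (Milne's proof: "the subalgebras … generated respectively by …"). [cite: Milne1999LefschetzClasses, §4 Prop. 4.1 (proof)] -/
theorem cross_wedge_compFst_two {m n q : ℕ} (h : m + n = q) (x : E₁ [⋀^Fin m]→L[ℝ] ℂ)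
    (y : E₂ [⋀^Fin n]→L[ℝ] ℂ) (e : E₁ [⋀^Fin 2]→L[ℝ] ℂ) :
    (((x.compContinuousLinearMap (ContinuousLinearMap.fst ℝ E₁ E₂)).wedge
        (y.compContinuousLinearMap (ContinuousLinearMap.snd ℝ E₁ E₂))).domDomCongr (finCongr h)).wedge
        (e.compContinuousLinearMap (ContinuousLinearMap.fst ℝ E₁ E₂)) =
      (((x.wedge e).compContinuousLinearMap (ContinuousLinearMap.fst ℝ E₁ E₂)).wedge
        (y.compContinuousLinearMap (ContinuousLinearMap.snd ℝ E₁ E₂))).domDomCongr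
          (finCongr (by omega : m + 2 + n = q + 2)) := by
  set X := x.compContinuousLinearMap (ContinuousLinearMap.fst ℝ E₁ E₂) with hX
  set Y := y.compContinuousLinearMap (ContinuousLinearMap.snd ℝ E₁ E₂) with hY
  set E' := e.compContinuousLinearMap (ContinuousLinearMap.fst ℝ E₁ E₂) with hE'
  have hL : GForm.of (q + 2) (((X.wedge Y).domDomCongr (finCongr h)).wedge E') =
      GForm.of m X * GForm.of n Y * GForm.of 2 E' := by
    rw [← GForm.of_mul_of, GForm.of_domDomCongr_finCongr, ← GForm.of_mul_of]
  have hR : GForm.of (q + 2) ((((x.wedge e).compContinuousLinearMap (ContinuousLinearMap.fst ℝ E₁ E₂)).wedge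
      Y).domDomCongr (finCongr (by omega : m + 2 + n = q + 2))) =
      GForm.of m X * GForm.of 2 E' * GForm.of n Y := by
    rw [GForm.of_domDomCongr_finCongr, ← GForm.of_mul_of,
      ContinuousAlternatingMap.wedge_compContinuousLinearMap, ← GForm.of_mul_of]
  apply GForm.of_injective (q + 2)
  rw [hL, hR, mul_assoc, mul_assoc, GForm.of_mul_comm_of_even (show Even 2 by norm_num) E' (GForm.of n Y)]

/-- **`(p₁^*x ∧ p₂^*y) ∧ p₂^*e = p₁^*x ∧ p₂^*(y ∧ e)`** (associativity of `∧` and multiplicativity of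
`p₂^*`), up to the reindexings of degrees. [cite: Milne1999LefschetzClasses, §4 Prop. 4.1 (proof)] -/
theorem cross_wedge_compSnd_two {m n q : ℕ} (h : m + n = q) (x : E₁ [⋀^Fin m]→L[ℝ] ℂ)
    (y : E₂ [⋀^Fin n]→L[ℝ] ℂ) (e : E₂ [⋀^Fin 2]→L[ℝ] ℂ) :
    (((x.compContinuousLinearMap (ContinuousLinearMap.fst ℝ E₁ E₂)).wedge
        (y.compContinuousLinearMap (ContinuousLinearMap.snd ℝ E₁ E₂))).domDomCongr (finCongr h)).wedge
        (e.compContinuousLinearMap (ContinuousLinearMap.snd ℝ E₁ E₂)) =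
      ((x.compContinuousLinearMap (ContinuousLinearMap.fst ℝ E₁ E₂)).wedge
        ((y.wedge e).compContinuousLinearMap (ContinuousLinearMap.snd ℝ E₁ E₂))).domDomCongr
          (finCongr (by omega : m + (n + 2) = q + 2)) := by
  set X := x.compContinuousLinearMap (ContinuousLinearMap.fst ℝ E₁ E₂) with hX
  set Y := y.compContinuousLinearMap (ContinuousLinearMap.snd ℝ E₁ E₂) with hY
  set E' := e.compContinuousLinearMap (ContinuousLinearMap.snd ℝ E₁ E₂) with hE'
  have hL : GForm.of (q + 2) (((X.wedge Y).domDomCongr (finCongr h)).wedge E') =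
      GForm.of m X * GForm.of n Y * GForm.of 2 E' := by
    rw [← GForm.of_mul_of, GForm.of_domDomCongr_finCongr, ← GForm.of_mul_of]
  have hR : GForm.of (q + 2) ((X.wedge ((y.wedge e).compContinuousLinearMap
      (ContinuousLinearMap.snd ℝ E₁ E₂))).domDomCongr (finCongr (by omega : m + (n + 2) = q + 2))) =
      GForm.of m X * (GForm.of n Y * GForm.of 2 E') := by
    rw [GForm.of_domDomCongr_finCongr, ← GForm.of_mul_of,
      ContinuousAlternatingMap.wedge_compContinuousLinearMap, ← GForm.of_mul_of]
  apply GForm.of_injective (q + 2)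
  rw [hL, hR, mul_assoc]

end FormAlgebra

/-! ## §1 Divisorial correspondences: the mixed part of `NS(X₁ × X₂)` -/

section Correspondences

variable {ι₁ ι₂ : Type*} [Fintype ι₁] [Fintype ι₂] [DecidableEq ι₁] [DecidableEq ι₂] {E₁ E₂ : Type*}
  [NormedAddCommGroup E₁] [NormedSpace ℂ E₁] [NormedAddCommGroup E₂] [NormedSpace ℂ E₂]
  (Φ₁ : (ι₁ → ℝ) ≃L[ℝ] E₁) (Φ₂ : (ι₂ → ℝ) ≃L[ℝ] E₂)

/-- **The mixed part of a `2`-form on `E₁ × E₂` is the off-diagonal block of its Gram matrix**: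
`η((Φ₁x, 0), (0, Φ₂y)) = ᵗx · G₁₂ · y` for the Gram matrix `G` of `η` on the concatenated lattice basis of
`X₁ × X₂`. [cite: HulekLaface2019PicardNumbersAV, §2.1 Prop. 2.2 (proof)] -/
theorem apply_inl_inr_eq_dotProduct_toBlocks₁₂ (η : (E₁ × E₂) [⋀^Fin 2]→L[ℝ] ℝ) (x : ι₁ → ℝ)
    (y : ι₂ → ℝ) :
    η ![(Φ₁ x, 0), (0, Φ₂ y)] = x ⬝ᵥ (latticeGram (prodPeriod Φ₁ Φ₂) η).toBlocks₁₂ *ᵥ y := by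
  have h := dotProduct_latticeGram_mulVec (prodPeriod Φ₁ Φ₂) η (Sum.elim x 0) (Sum.elim 0 y)
  have h₁ : prodPeriod Φ₁ Φ₂ (Sum.elim x 0) = (Φ₁ x, 0) := by
    rw [prodPeriod_apply]
    refine Prod.ext rfl ?_
    change Φ₂ (fun _ ↦ (0 : ℝ)) = 0
    exact map_zero Φ₂
  have h₂ : prodPeriod Φ₁ Φ₂ (Sum.elim 0 y) = (0, Φ₂ y) := by
    rw [prodPeriod_apply]
    refine Prod.ext ?_ rfl
    change Φ₁ (fun _ ↦ (0 : ℝ)) = 0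
    exact map_zero Φ₁
  rw [h₁, h₂] at h
  rw [← h]
  conv_lhs => rw [← Matrix.fromBlocks_toBlocks (latticeGram (prodPeriod Φ₁ Φ₂) η)]
  rw [Matrix.fromBlocks_mulVec, sumElim_dotProduct_sumElim]
  simp [Sum.elim_comp_inl, Sum.elim_comp_inr, Matrix.mulVec_zero]

/-- **`DC(X₁, X₂) ⊗ ℚ = 0` iff `nsCross Φ₁ Φ₂ = ⊥`**: every divisor class `η ∈ NS(X₁ × X₂)` has vanishing
mixed part `η((u, 0), (0, w))` (its divisorial-correspondence class is zero) if and only if the cross term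
of the block decomposition `NS_ℚ(X₁ × X₂) ≅ NS_ℚ(X₁) ⊕ NS_ℚ(X₂) ⊕ nsCross` vanishes ("a canonical
decomposition `NS(X × Y) ≅ NS(X) ⊕ NS(Y) ⊕ DC(X, Y)` … compatible with the Künneth decomposition").
[cite: Milne1999LefschetzClasses, §4 Prop. 4.1 (proof)] [cite: HulekLaface2019PicardNumbersAV, §2.1 Prop. 2.2] -/
theorem forall_apply_inl_inr_eq_zero_iff_nsCross_eq_bot :
    (∀ η : (E₁ × E₂) [⋀^Fin 2]→L[ℝ] ℝ, IsNSForm (prodPeriod Φ₁ Φ₂) η →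
        ∀ (u : E₁) (w : E₂), η ![(u, 0), (0, w)] = 0) ↔ nsCross Φ₁ Φ₂ = ⊥ := by
  constructor
  · -- (⟹) a cross matrix `M` is the off-diagonal block of the class `(0 M; -ᵗM 0)`, an integral
    -- multiple of which lies in `NS(X₁ × X₂)`
    intro h
    refine (Submodule.eq_bot_iff _).2 fun M hM ↦ ?_
    have hG : Matrix.fromBlocks 0 M (-M.transpose) 0 ∈ nsGramQ (prodPeriod Φ₁ Φ₂) :=
      fromBlocks_mem_nsGramQ_prod Φ₁ Φ₂ (Submodule.zero_mem _) (Submodule.zero_mem _) hM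
    obtain ⟨η, hη, hηG⟩ := exists_ratGram_eq (prodPeriod Φ₁ Φ₂) hG
    obtain ⟨N, hN, hNη⟩ := exists_nsmul_mem_neronSeveriGroup (prodPeriod Φ₁ Φ₂) hη
    have hNS : IsNSForm (prodPeriod Φ₁ Φ₂) ((N : ℝ) • η) := (mem_neronSeveriGroup_iff _).1 hNη
    -- the mixed part of `η` itself vanishes
    have h' : ∀ (u : E₁) (w : E₂), η ![(u, 0), (0, w)] = 0 := fun u w ↦ by
      have huw := h _ hNS u w
      rw [ContinuousAlternatingMap.smul_apply, smul_eq_zero] at huw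
      exact huw.resolve_left (Nat.cast_ne_zero.2 hN.ne')
    -- its Gram matrix has off-diagonal block `M`
    have hblock : (latticeGram (prodPeriod Φ₁ Φ₂) η).toBlocks₁₂ = M.map ((↑) : ℚ → ℝ) := by
      rw [← map_ratGram _ hη, hηG, Matrix.fromBlocks_map, Matrix.toBlocks_fromBlocks₁₂]
    ext i j
    have hij := h' (Φ₁ (Pi.single i 1)) (Φ₂ (Pi.single j 1))
    rw [apply_inl_inr_eq_dotProduct_toBlocks₁₂, hblock, Matrix.mulVec_single_one, single_one_dotProduct] at hij
    have hij' : ((M i j : ℚ) : ℝ) = 0 := by simpa [Matrix.map_apply] using hij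
    rw [Matrix.zero_apply]
    exact_mod_cast hij'
  · -- (⟸) the off-diagonal block of the Gram matrix of `η` lies in `nsCross = ⊥`
    intro h η hη u w
    have hηQ := mem_neronSeveriQ_of_isNSForm (prodPeriod Φ₁ Φ₂) hη
    have hM : (ratGram (prodPeriod Φ₁ Φ₂) η).toBlocks₁₂ = 0 := by
      have hmem := (toBlocks_mem_of_mem_nsGramQ_prod Φ₁ Φ₂ (ratGram_mem_nsGramQ _ hηQ)).2.2.1
      rw [h, Submodule.mem_bot] at hmem
      exact hmem
    have hM' : (latticeGram (prodPeriod Φ₁ Φ₂) η).toBlocks₁₂ = 0 := by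
      rw [← map_ratGram _ hηQ]
      ext i j
      have := congrFun (congrFun hM i) j
      simp only [Matrix.toBlocks₁₂, Matrix.of_apply, Matrix.zero_apply] at this ⊢
      rw [Matrix.map_apply, this, Rat.cast_zero]
    obtain ⟨x, rfl⟩ := Φ₁.surjective u
    obtain ⟨y, rfl⟩ := Φ₂.surjective w
    rw [apply_inl_inr_eq_dotProduct_toBlocks₁₂, hM', Matrix.zero_mulVec, dotProduct_zero]

/-- **`Hom_ℚ(X₂, X̂₁) = 0 ⟹ DC(X₁, X₂) ⊗ ℚ = 0`** (`nsCross Φ₁ Φ₂ = Hom_ℚ(X₂, X̂₁)`: "`DC(X, Y) ≅ Hom(A, B)`,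
where `A` is the Albanese variety of `X` and `B` is the Picard variety of `Y`").
[cite: Milne1999LefschetzClasses, §4 Cor. 4.2 (proof)] -/
theorem forall_apply_inl_inr_eq_zero_of_homRat_dualPeriod_eq_bot (h : homRat Φ₂ (dualPeriod Φ₁) = ⊥)
    (η : (E₁ × E₂) [⋀^Fin 2]→L[ℝ] ℝ) (hη : IsNSForm (prodPeriod Φ₁ Φ₂) η) (u : E₁) (w : E₂) :
    η ![(u, 0), (0, w)] = 0 :=
  (forall_apply_inl_inr_eq_zero_iff_nsCross_eq_bot Φ₁ Φ₂).2 (by rwa [nsCross_eq_homRat_dualPeriod]) η hη u w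

/-- **`Hom_ℚ(X₂, X₁) = 0 ⟹ DC(X₁, X₂) ⊗ ℚ = 0` when `X₁` carries a non-degenerate class of `NS_ℚ(X₁)`**
(every abelian variety does; `nsCross Φ₁ Φ₂ ≅ Hom_ℚ(X₂, X₁)` by `nsCrossEquivHomRat`) — the form of the
hypothesis used in Cor. 4.2 ("if `A` and `B` are abelian varieties with `Hom(A, B) = 0`, then
`DC(A, B) = 0`"). [cite: Milne1999LefschetzClasses, §4 Cor. 4.2 (proof)] -/
theorem forall_apply_inl_inr_eq_zero_of_homRat_eq_bot (h₁ : ∃ G₀ ∈ nsGramQ Φ₁, IsUnit G₀.det)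
    (h : homRat Φ₂ Φ₁ = ⊥) (η : (E₁ × E₂) [⋀^Fin 2]→L[ℝ] ℝ) (hη : IsNSForm (prodPeriod Φ₁ Φ₂) η)
    (u : E₁) (w : E₂) : η ![(u, 0), (0, w)] = 0 := by
  obtain ⟨G₀, hG₀, hdet⟩ := h₁
  have h0 : finrank ℚ (nsCross Φ₁ Φ₂) = 0 := by
    rw [finrank_nsCross_eq_finrank_homRat Φ₂ hG₀ hdet, h, finrank_bot]
  exact (forall_apply_inl_inr_eq_zero_iff_nsCross_eq_bot Φ₁ Φ₂).2 (Submodule.finrank_eq_zero.1 h0) η hη u w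

/-- **`Hom_ℚ(X₂, X₁) = 0 ⟹ DC(X₁, X₂) ⊗ ℚ = 0` for an abelian variety `X₁`** and any complex torus `X₂`.
[cite: Milne1999LefschetzClasses, §4 Cor. 4.2 (proof)] -/
theorem IsAbelianVariety.forall_apply_inl_inr_eq_zero_of_homRat_eq_bot {Φ₁ : (ι₁ → ℝ) ≃L[ℝ] E₁}
    (h₁ : IsAbelianVariety Φ₁) (h : homRat Φ₂ Φ₁ = ⊥) (η : (E₁ × E₂) [⋀^Fin 2]→L[ℝ] ℝ)
    (hη : IsNSForm (prodPeriod Φ₁ Φ₂) η) (u : E₁) (w : E₂) : η ![(u, 0), (0, w)] = 0 :=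
  ComplexTorus.forall_apply_inl_inr_eq_zero_of_homRat_eq_bot Φ₁ Φ₂ h₁.exists_mem_nsGramQ_isUnit_det h η hη u w

/-- **`Hom_ℚ(X₁, X₂) = 0 ⟹ DC(X₁, X₂) ⊗ ℚ = 0` when `X₂` carries a non-degenerate class of `NS_ℚ(X₂)`**
(the mirror form: `dim nsCross Φ₁ Φ₂ = dim Hom_ℚ(X₁, X₂)`). [cite: Milne1999LefschetzClasses, §4 Cor. 4.2 (proof)] -/
theorem forall_apply_inl_inr_eq_zero_of_homRat_eq_bot' (h₂ : ∃ G₂ ∈ nsGramQ Φ₂, IsUnit G₂.det)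
    (h : homRat Φ₁ Φ₂ = ⊥) (η : (E₁ × E₂) [⋀^Fin 2]→L[ℝ] ℝ) (hη : IsNSForm (prodPeriod Φ₁ Φ₂) η)
    (u : E₁) (w : E₂) : η ![(u, 0), (0, w)] = 0 := by
  obtain ⟨G₂, hG₂, hdet⟩ := h₂
  have h0 : finrank ℚ (nsCross Φ₁ Φ₂) = 0 := by
    rw [finrank_nsCross_eq_finrank_homRat' Φ₁ hG₂ hdet, h, finrank_bot]
  exact (forall_apply_inl_inr_eq_zero_iff_nsCross_eq_bot Φ₁ Φ₂).2 (Submodule.finrank_eq_zero.1 h0) η hη u w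

/-- **`Hom_ℚ(X₁, X₂) = 0 ⟹ DC(X₁, X₂) ⊗ ℚ = 0` for an abelian variety `X₂`** and any complex torus `X₁`.
[cite: Milne1999LefschetzClasses, §4 Cor. 4.2 (proof)] -/
theorem IsAbelianVariety.forall_apply_inl_inr_eq_zero_of_homRat_eq_bot' {Φ₂ : (ι₂ → ℝ) ≃L[ℝ] E₂}
    (h₂ : IsAbelianVariety Φ₂) (h : homRat Φ₁ Φ₂ = ⊥) (η : (E₁ × E₂) [⋀^Fin 2]→L[ℝ] ℝ)
    (hη : IsNSForm (prodPeriod Φ₁ Φ₂) η) (u : E₁) (w : E₂) : η ![(u, 0), (0, w)] = 0 :=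
  ComplexTorus.forall_apply_inl_inr_eq_zero_of_homRat_eq_bot' Φ₁ Φ₂ h₂.exists_mem_nsGramQ_isUnit_det h η hη u w

end Correspondences

/-! ## §2 Codimension one: `D¹(X₁ × X₂) = p₁^*D¹(X₁) + p₂^*D¹(X₂)` when `DC(X₁, X₂) ⊗ ℚ = 0` -/

section CodimOne

variable {ι₁ ι₂ : Type*} [Fintype ι₁] [Fintype ι₂] [DecidableEq ι₁] [DecidableEq ι₂] {E₁ E₂ : Type*}
  [NormedAddCommGroup E₁] [NormedSpace ℂ E₁] [NormedAddCommGroup E₂] [NormedSpace ℂ E₂]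
  (Φ₁ : (ι₁ → ℝ) ≃L[ℝ] E₁) (Φ₂ : (ι₂ → ℝ) ≃L[ℝ] E₂)

omit [DecidableEq ι₂] in
/-- **`ι₁^* NS(X₁ × X₂) ⊆ NS(X₁)`**: the restriction of a divisor class of the product to `X₁ × {0}` is a
divisor class of `X₁` (pull-back along the holomorphic homomorphism `ι₁ = (·, 0)`).
[cite: Milne1999LefschetzClasses, §4 Prop. 4.1 (proof: "`NS(X × Y) ≅ NS(X) ⊕ NS(Y) ⊕ DC(X, Y)`")] -/
theorem IsNSForm.comp_inl {η : (E₁ × E₂) [⋀^Fin 2]→L[ℝ] ℝ} (hη : IsNSForm (prodPeriod Φ₁ Φ₂) η) :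
    IsNSForm Φ₁ (η.compContinuousLinearMap (ContinuousLinearMap.inl ℝ E₁ E₂)) := by
  have h := IsNSForm.comp_realRep Φ₁ (prodPeriod Φ₁ Φ₂) (inlMatrix ι₁ ι₂) (realRep_inlMatrix_smul Φ₁ Φ₂) hη
  rwa [realRep_inlMatrix] at h

omit [DecidableEq ι₁] in
/-- **`ι₂^* NS(X₁ × X₂) ⊆ NS(X₂)`** (restriction to `{0} × X₂`). [cite: Milne1999LefschetzClasses, §4 Prop. 4.1 (proof)] -/
theorem IsNSForm.comp_inr {η : (E₁ × E₂) [⋀^Fin 2]→L[ℝ] ℝ} (hη : IsNSForm (prodPeriod Φ₁ Φ₂) η) :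
    IsNSForm Φ₂ (η.compContinuousLinearMap (ContinuousLinearMap.inr ℝ E₁ E₂)) := by
  have h := IsNSForm.comp_realRep Φ₂ (prodPeriod Φ₁ Φ₂) (inrMatrix ι₁ ι₂) (realRep_inrMatrix_smul Φ₁ Φ₂) hη
  rwa [realRep_inrMatrix] at h

omit [DecidableEq ι₁] [DecidableEq ι₂] in
/-- **`E = p₁^*(ι₁^*E) + p₂^*(ι₂^*E)` for every `E ∈ NS(X₁ × X₂)` when `DC(X₁, X₂) ⊗ ℚ = 0`**: a divisor
class of the product with vanishing divisorial-correspondence part is the sum of the pull-backs of its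
restrictions to the factors ("`NS(X × Y) ≅ NS(X) ⊕ NS(Y) ⊕ DC(X, Y)` … By assumption `DC(X, Y) = 0`").
[cite: Milne1999LefschetzClasses, §4 Prop. 4.1 (proof)] -/
theorem ofRealForm_eq_compFst_add_compSnd
    (hDC : ∀ η : (E₁ × E₂) [⋀^Fin 2]→L[ℝ] ℝ, IsNSForm (prodPeriod Φ₁ Φ₂) η →
      ∀ (u : E₁) (w : E₂), η ![(u, 0), (0, w)] = 0)
    {η : (E₁ × E₂) [⋀^Fin 2]→L[ℝ] ℝ} (hη : IsNSForm (prodPeriod Φ₁ Φ₂) η) :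
    ofRealForm η =
      (ofRealForm (η.compContinuousLinearMap (ContinuousLinearMap.inl ℝ E₁ E₂))).compContinuousLinearMap
          (ContinuousLinearMap.fst ℝ E₁ E₂) +
        (ofRealForm (η.compContinuousLinearMap (ContinuousLinearMap.inr ℝ E₁ E₂))).compContinuousLinearMap
          (ContinuousLinearMap.snd ℝ E₁ E₂) := by
  conv_lhs => rw [twoForm_eq_compFst_add_compSnd_of_apply_inl_inr_eq_zero η (hDC η hη)]
  rw [ofRealForm_add, ofRealForm_compContinuousLinearMap, ofRealForm_compContinuousLinearMap,
    ofRealForm_compContinuousLinearMap, ofRealForm_compContinuousLinearMap]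

/-- **`D¹(X₁ × X₂) ⊆ p₁^*D¹(X₁) + p₂^*D¹(X₂)` when `DC(X₁, X₂) ⊗ ℚ = 0`**: every codimension-one Lefschetz
class of the product is `p₁^*a + p₂^*b` with `a ∈ D¹(X₁)`, `b ∈ D¹(X₂)` (and conversely every such sum is
in `D¹(X₁ × X₂)`, row Q605 `compContinuousLinearMap_fst/snd_mem_divisorClasses`).
[cite: Milne1999LefschetzClasses, §4 Prop. 4.1 (proof: "`D¹(X × Y)_k = D¹(X)_k ⊕ D¹(Y)_k`")] -/
theorem exists_eq_compFst_add_compSnd_of_mem_divisorClasses_one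
    (hDC : ∀ η : (E₁ × E₂) [⋀^Fin 2]→L[ℝ] ℝ, IsNSForm (prodPeriod Φ₁ Φ₂) η →
      ∀ (u : E₁) (w : E₂), η ![(u, 0), (0, w)] = 0)
    {γ : (E₁ × E₂) [⋀^Fin (2 * 1)]→L[ℝ] ℂ} (hγ : γ ∈ divisorClasses (prodPeriod Φ₁ Φ₂) 1) :
    ∃ a ∈ divisorClasses Φ₁ 1, ∃ b ∈ divisorClasses Φ₂ 1,
      γ = a.compContinuousLinearMap (ContinuousLinearMap.fst ℝ E₁ E₂) +
        b.compContinuousLinearMap (ContinuousLinearMap.snd ℝ E₁ E₂) := by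
  rw [divisorClasses_one_eq_hodgeClasses, hodgeClasses_one_eq_span_neronSeveri] at hγ
  induction hγ using Submodule.span_induction with
  | mem _ h =>
    obtain ⟨η, hη, rfl⟩ := h
    have hη' : IsNSForm (prodPeriod Φ₁ Φ₂) η := (mem_neronSeveriGroup_iff _).1 hη
    refine ⟨ofRealForm (η.compContinuousLinearMap (ContinuousLinearMap.inl ℝ E₁ E₂)), ?_,
      ofRealForm (η.compContinuousLinearMap (ContinuousLinearMap.inr ℝ E₁ E₂)), ?_,
      ofRealForm_eq_compFst_add_compSnd Φ₁ Φ₂ hDC hη'⟩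
    · rw [divisorClasses_one_eq_hodgeClasses]
      exact ofRealForm_mem_hodgeClasses_one Φ₁ (hη'.comp_inl Φ₁ Φ₂)
    · rw [divisorClasses_one_eq_hodgeClasses]
      exact ofRealForm_mem_hodgeClasses_one Φ₂ (hη'.comp_inr Φ₁ Φ₂)
  | zero =>
    refine ⟨0, Submodule.zero_mem _, 0, Submodule.zero_mem _, ?_⟩
    ext v
    simp
  | add _ _ _ _ h h' =>
    obtain ⟨a, ha, b, hb, rfl⟩ := h
    obtain ⟨a', ha', b', hb', rfl⟩ := h'
    refine ⟨a + a', Submodule.add_mem _ ha ha', b + b', Submodule.add_mem _ hb hb', ?_⟩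
    ext v
    simp only [ContinuousAlternatingMap.add_apply, ContinuousAlternatingMap.compContinuousLinearMap_apply]
    abel
  | smul c _ _ h =>
    obtain ⟨a, ha, b, hb, rfl⟩ := h
    refine ⟨c • a, Submodule.smul_mem _ c ha, c • b, Submodule.smul_mem _ c hb, ?_⟩
    ext v
    simp only [ContinuousAlternatingMap.smul_apply, ContinuousAlternatingMap.add_apply,
      ContinuousAlternatingMap.compContinuousLinearMap_apply, smul_add]

end CodimOne

/-! ## §3 Proposition 4.1: every Lefschetz class of `X₁ × X₂` is a sum of cross products -/

section Surjective

variable {ι₁ ι₂ : Type*} [Fintype ι₁] [Fintype ι₂] [DecidableEq ι₁] [DecidableEq ι₂] {E₁ E₂ : Type*}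
  [NormedAddCommGroup E₁] [NormedSpace ℂ E₁] [NormedAddCommGroup E₂] [NormedSpace ℂ E₂]
  (Φ₁ : (ι₁ → ℝ) ≃L[ℝ] E₁) (Φ₂ : (ι₂ → ℝ) ≃L[ℝ] E₂)

/-- **The generators `p₁^*x ∧ p₂^*y` (`x ∈ Dᵃ(X₁)`, `y ∈ Dᵇ(X₂)`, read in degree `2p` along any
`2a + 2b = 2p`) are Lefschetz classes of `X₁ × X₂`** — the easy inclusion
`D•(X₁) ⊗ D•(X₂) → D•(X₁ × X₂)` of Prop. 4.1, valid for every pair of tori (row Q605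
`cross_mem_divisorClasses`, re-read along an arbitrary degree equation).
[cite: Milne1999LefschetzClasses, §4 Prop. 4.1] -/
theorem cross_mem_divisorClasses_of_eq {a b p : ℕ} (h : 2 * a + 2 * b = 2 * p)
    {x : E₁ [⋀^Fin (2 * a)]→L[ℝ] ℂ} {y : E₂ [⋀^Fin (2 * b)]→L[ℝ] ℂ} (hx : x ∈ divisorClasses Φ₁ a)
    (hy : y ∈ divisorClasses Φ₂ b) :
    ((x.compContinuousLinearMap (ContinuousLinearMap.fst ℝ E₁ E₂)).wedge
        (y.compContinuousLinearMap (ContinuousLinearMap.snd ℝ E₁ E₂))).domDomCongr (finCongr h) ∈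
      divisorClasses (prodPeriod Φ₁ Φ₂) p := by
  obtain rfl : p = a + b := by omega
  exact cross_mem_divisorClasses Φ₁ Φ₂ hx hy

/-- **`(D•(X₁) ⊗ D•(X₂))ᵖ ⊆ Dᵖ(X₁ × X₂)`** for every pair of complex tori: the `ℚ`-span of the cross
products `p₁^*x ∧ p₂^*y`, `x ∈ Dᵃ(X₁)`, `y ∈ Dᵇ(X₂)`, `a + b = p`, consists of Lefschetz classes.
[cite: Milne1999LefschetzClasses, §4 Prop. 4.1] -/
theorem span_cross_le_divisorClasses_prod (p : ℕ) :
    Submodule.span ℚ {γ : (E₁ × E₂) [⋀^Fin (2 * p)]→L[ℝ] ℂ |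
        ∃ (a b : ℕ) (h : 2 * a + 2 * b = 2 * p) (x : E₁ [⋀^Fin (2 * a)]→L[ℝ] ℂ)
          (y : E₂ [⋀^Fin (2 * b)]→L[ℝ] ℂ), x ∈ divisorClasses Φ₁ a ∧ y ∈ divisorClasses Φ₂ b ∧
          γ = ((x.compContinuousLinearMap (ContinuousLinearMap.fst ℝ E₁ E₂)).wedge
            (y.compContinuousLinearMap (ContinuousLinearMap.snd ℝ E₁ E₂))).domDomCongr (finCongr h)} ≤
      divisorClasses (prodPeriod Φ₁ Φ₂) p := by
  refine Submodule.span_le.2 ?_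
  rintro _ ⟨a, b, h, x, y, hx, hy, rfl⟩
  exact cross_mem_divisorClasses_of_eq Φ₁ Φ₂ h hx hy

/-- **The span of the cross products is stable under `· ∧ E`, `E ∈ NS(X₁ × X₂)`, when
`DC(X₁, X₂) ⊗ ℚ = 0`**: `E = p₁^*E₁ + p₂^*E₂` with `Eᵢ ∈ NS(Xᵢ)` (§2) and
`(p₁^*x ∧ p₂^*y) ∧ p₁^*E₁ = p₁^*(x ∧ E₁) ∧ p₂^*y`, `(p₁^*x ∧ p₂^*y) ∧ p₂^*E₂ = p₁^*x ∧ p₂^*(y ∧ E₂)` (§0)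
with `x ∧ E₁ ∈ Dᵃ⁺¹(X₁)`, `y ∧ E₂ ∈ Dᵇ⁺¹(X₂)` (row A4-29) — the heart of Milne's "the subalgebras …
generated respectively by `D¹(X × Y)_k` and `D¹(X)_k ⊕ D¹(Y)_k` … are therefore equal".
[cite: Milne1999LefschetzClasses, §4 Prop. 4.1 (proof)] -/
theorem wedge_ofRealForm_mem_span_cross
    (hDC : ∀ η : (E₁ × E₂) [⋀^Fin 2]→L[ℝ] ℝ, IsNSForm (prodPeriod Φ₁ Φ₂) η →
      ∀ (u : E₁) (w : E₂), η ![(u, 0), (0, w)] = 0)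
    (p : ℕ) {γ : (E₁ × E₂) [⋀^Fin (2 * p)]→L[ℝ] ℂ}
    (hγ : γ ∈ Submodule.span ℚ {γ : (E₁ × E₂) [⋀^Fin (2 * p)]→L[ℝ] ℂ |
        ∃ (a b : ℕ) (h : 2 * a + 2 * b = 2 * p) (x : E₁ [⋀^Fin (2 * a)]→L[ℝ] ℂ)
          (y : E₂ [⋀^Fin (2 * b)]→L[ℝ] ℂ), x ∈ divisorClasses Φ₁ a ∧ y ∈ divisorClasses Φ₂ b ∧
          γ = ((x.compContinuousLinearMap (ContinuousLinearMap.fst ℝ E₁ E₂)).wedge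
            (y.compContinuousLinearMap (ContinuousLinearMap.snd ℝ E₁ E₂))).domDomCongr (finCongr h)})
    {η : (E₁ × E₂) [⋀^Fin 2]→L[ℝ] ℝ} (hη : IsNSForm (prodPeriod Φ₁ Φ₂) η) :
    γ.wedge (ofRealForm η) ∈ Submodule.span ℚ {γ : (E₁ × E₂) [⋀^Fin (2 * (p + 1))]→L[ℝ] ℂ |
        ∃ (a b : ℕ) (h : 2 * a + 2 * b = 2 * (p + 1)) (x : E₁ [⋀^Fin (2 * a)]→L[ℝ] ℂ)
          (y : E₂ [⋀^Fin (2 * b)]→L[ℝ] ℂ), x ∈ divisorClasses Φ₁ a ∧ y ∈ divisorClasses Φ₂ b ∧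
          γ = ((x.compContinuousLinearMap (ContinuousLinearMap.fst ℝ E₁ E₂)).wedge
            (y.compContinuousLinearMap (ContinuousLinearMap.snd ℝ E₁ E₂))).domDomCongr (finCongr h)} := by
  induction hγ using Submodule.span_induction with
  | mem γ h =>
    obtain ⟨a, b, h, x, y, hx, hy, rfl⟩ := h
    rw [ofRealForm_eq_compFst_add_compSnd Φ₁ Φ₂ hDC hη, ContinuousAlternatingMap.wedge_add_right,
      cross_wedge_compFst_two h, cross_wedge_compSnd_two h]
    refine Submodule.add_mem _ (Submodule.subset_span ⟨a + 1, b, by omega, _, y, ?_, hy, rfl⟩)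
      (Submodule.subset_span ⟨a, b + 1, by omega, x, _, hx, ?_, rfl⟩)
    · exact wedge_ofRealForm_mem_divisorClasses Φ₁ hx (hη.comp_inl Φ₁ Φ₂)
    · exact wedge_ofRealForm_mem_divisorClasses Φ₂ hy (hη.comp_inr Φ₁ Φ₂)
  | zero =>
    rw [ContinuousAlternatingMap.zero_wedge]
    exact Submodule.zero_mem _
  | add _ _ _ _ h h' =>
    rw [ContinuousAlternatingMap.wedge_add_left]
    exact Submodule.add_mem _ h h'
  | smul c γ _ h =>
    rw [← Rat.cast_smul_eq_qsmul ℂ c, wedge_smul_left_complex, Rat.cast_smul_eq_qsmul]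
    exact Submodule.smul_mem _ c h

/-- **PROPOSITION 4.1 (Milne 1999), at torus level — the Künneth formula for Lefschetz classes.** If the
`ℚ`-space of divisorial correspondences between the complex tori `X₁`, `X₂` vanishes
(`DC(X₁, X₂) ⊗ ℚ = 0`: every divisor class of `X₁ × X₂` has zero mixed Künneth part; equivalently
`Hom_ℚ(X₂, X̂₁) = 0`, §1), then for every `p`
`Dᵖ(X₁ × X₂) = Σ_{a+b=p} p₁^*Dᵃ(X₁) ∧ p₂^*Dᵇ(X₂)`: the map `x ⊗ y ↦ p₁^*x ∧ p₂^*y`,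
`⊕_{a+b=p} Dᵃ(X₁) ⊗ Dᵇ(X₂) → Dᵖ(X₁ × X₂)`, is ONTO (it is one-to-one for every pair of tori, §4).
Proof as printed: both sides are the subalgebra generated by `D¹(X₁ × X₂) = p₁^*D¹(X₁) ⊕ p₂^*D¹(X₂)` —
here via the universal property of `D•` (row A4-29 `divisorClasses_le_of_forall_wedge_ofRealForm_mem`).
[cite: Milne1999LefschetzClasses, §4 Prop. 4.1] -/
theorem divisorClasses_prod_eq_span_cross
    (hDC : ∀ η : (E₁ × E₂) [⋀^Fin 2]→L[ℝ] ℝ, IsNSForm (prodPeriod Φ₁ Φ₂) η →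
      ∀ (u : E₁) (w : E₂), η ![(u, 0), (0, w)] = 0) (p : ℕ) :
    divisorClasses (prodPeriod Φ₁ Φ₂) p = Submodule.span ℚ {γ : (E₁ × E₂) [⋀^Fin (2 * p)]→L[ℝ] ℂ |
        ∃ (a b : ℕ) (h : 2 * a + 2 * b = 2 * p) (x : E₁ [⋀^Fin (2 * a)]→L[ℝ] ℂ)
          (y : E₂ [⋀^Fin (2 * b)]→L[ℝ] ℂ), x ∈ divisorClasses Φ₁ a ∧ y ∈ divisorClasses Φ₂ b ∧
          γ = ((x.compContinuousLinearMap (ContinuousLinearMap.fst ℝ E₁ E₂)).wedge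
            (y.compContinuousLinearMap (ContinuousLinearMap.snd ℝ E₁ E₂))).domDomCongr (finCongr h)} := by
  refine le_antisymm ?_ (span_cross_le_divisorClasses_prod Φ₁ Φ₂ p)
  refine divisorClasses_le_of_forall_wedge_ofRealForm_mem (prodPeriod Φ₁ Φ₂)
    (fun p ↦ Submodule.span ℚ {γ : (E₁ × E₂) [⋀^Fin (2 * p)]→L[ℝ] ℂ |
        ∃ (a b : ℕ) (h : 2 * a + 2 * b = 2 * p) (x : E₁ [⋀^Fin (2 * a)]→L[ℝ] ℂ)
          (y : E₂ [⋀^Fin (2 * b)]→L[ℝ] ℂ), x ∈ divisorClasses Φ₁ a ∧ y ∈ divisorClasses Φ₂ b ∧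
          γ = ((x.compContinuousLinearMap (ContinuousLinearMap.fst ℝ E₁ E₂)).wedge
            (y.compContinuousLinearMap (ContinuousLinearMap.snd ℝ E₁ E₂))).domDomCongr (finCongr h)})
    ?_ (fun q γ hγ η hη ↦ wedge_ofRealForm_mem_span_cross Φ₁ Φ₂ hDC q hγ hη) p
  -- `1 = p₁^*1 ∧ p₂^*1`
  refine Submodule.subset_span ⟨0, 0, rfl, oneForm₀ E₁, oneForm₀ E₂, ?_, ?_, ?_⟩
  · rw [divisorClasses_zero]
    exact Submodule.mem_span_singleton_self _
  · rw [divisorClasses_zero]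
    exact Submodule.mem_span_singleton_self _
  · rw [oneForm₀_compContinuousLinearMap, oneForm₀_compContinuousLinearMap, wedge_oneForm₀]
    rfl

/-- **Prop. 4.1 with the hypothesis `nsCross Φ₁ Φ₂ = ⊥`** (the matrix model of `DC(X₁, X₂) ⊗ ℚ = 0`).
[cite: Milne1999LefschetzClasses, §4 Prop. 4.1] -/
theorem divisorClasses_prod_eq_span_cross_of_nsCross_eq_bot (h : nsCross Φ₁ Φ₂ = ⊥) (p : ℕ) :
    divisorClasses (prodPeriod Φ₁ Φ₂) p = Submodule.span ℚ {γ : (E₁ × E₂) [⋀^Fin (2 * p)]→L[ℝ] ℂ |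
        ∃ (a b : ℕ) (h : 2 * a + 2 * b = 2 * p) (x : E₁ [⋀^Fin (2 * a)]→L[ℝ] ℂ)
          (y : E₂ [⋀^Fin (2 * b)]→L[ℝ] ℂ), x ∈ divisorClasses Φ₁ a ∧ y ∈ divisorClasses Φ₂ b ∧
          γ = ((x.compContinuousLinearMap (ContinuousLinearMap.fst ℝ E₁ E₂)).wedge
            (y.compContinuousLinearMap (ContinuousLinearMap.snd ℝ E₁ E₂))).domDomCongr (finCongr h)} :=
  divisorClasses_prod_eq_span_cross Φ₁ Φ₂ ((forall_apply_inl_inr_eq_zero_iff_nsCross_eq_bot Φ₁ Φ₂).2 h) p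

/-- **Prop. 4.1 with the hypothesis `Hom_ℚ(X₂, X̂₁) = 0`** ("`DC(X, Y) ≅ Hom(A, B)` … `B` the Picard
variety of `Y`"). [cite: Milne1999LefschetzClasses, §4 Prop. 4.1 and Cor. 4.2 (proof)] -/
theorem divisorClasses_prod_eq_span_cross_of_homRat_dualPeriod_eq_bot
    (h : homRat Φ₂ (dualPeriod Φ₁) = ⊥) (p : ℕ) :
    divisorClasses (prodPeriod Φ₁ Φ₂) p = Submodule.span ℚ {γ : (E₁ × E₂) [⋀^Fin (2 * p)]→L[ℝ] ℂ |
        ∃ (a b : ℕ) (h : 2 * a + 2 * b = 2 * p) (x : E₁ [⋀^Fin (2 * a)]→L[ℝ] ℂ)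
          (y : E₂ [⋀^Fin (2 * b)]→L[ℝ] ℂ), x ∈ divisorClasses Φ₁ a ∧ y ∈ divisorClasses Φ₂ b ∧
          γ = ((x.compContinuousLinearMap (ContinuousLinearMap.fst ℝ E₁ E₂)).wedge
            (y.compContinuousLinearMap (ContinuousLinearMap.snd ℝ E₁ E₂))).domDomCongr (finCongr h)} :=
  divisorClasses_prod_eq_span_cross Φ₁ Φ₂
    (forall_apply_inl_inr_eq_zero_of_homRat_dualPeriod_eq_bot Φ₁ Φ₂ h) p

/-- **COROLLARY 4.2 (Milne 1999), binary building block, at torus level**: for an abelian variety `X₁`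
and a complex torus `X₂` with `Hom_ℚ(X₂, X₁) = 0`, every Lefschetz class of `X₁ × X₂` is a sum of cross
products of Lefschetz classes of the factors: `Dᵖ(X₁ × X₂) = Σ_{a+b=p} p₁^*Dᵃ(X₁) ∧ p₂^*Dᵇ(X₂)`
("if `A` and `B` are abelian varieties with `Hom(A, B) = 0`, then `DC(A, B) = 0` and the projection maps
define an isomorphism `D(A)_k ⊗ D(B)_k → D(A × B)_k`"; the `r`-fold statement "follows from this by
induction"). [cite: Milne1999LefschetzClasses, §4 Cor. 4.2] -/
theorem IsAbelianVariety.divisorClasses_prod_eq_span_cross_of_homRat_eq_bot {Φ₁ : (ι₁ → ℝ) ≃L[ℝ] E₁}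
    (h₁ : IsAbelianVariety Φ₁) (h : homRat Φ₂ Φ₁ = ⊥) (p : ℕ) :
    divisorClasses (prodPeriod Φ₁ Φ₂) p = Submodule.span ℚ {γ : (E₁ × E₂) [⋀^Fin (2 * p)]→L[ℝ] ℂ |
        ∃ (a b : ℕ) (h : 2 * a + 2 * b = 2 * p) (x : E₁ [⋀^Fin (2 * a)]→L[ℝ] ℂ)
          (y : E₂ [⋀^Fin (2 * b)]→L[ℝ] ℂ), x ∈ divisorClasses Φ₁ a ∧ y ∈ divisorClasses Φ₂ b ∧
          γ = ((x.compContinuousLinearMap (ContinuousLinearMap.fst ℝ E₁ E₂)).wedge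
            (y.compContinuousLinearMap (ContinuousLinearMap.snd ℝ E₁ E₂))).domDomCongr (finCongr h)} :=
  divisorClasses_prod_eq_span_cross Φ₁ Φ₂ (h₁.forall_apply_inl_inr_eq_zero_of_homRat_eq_bot Φ₂ h) p

/-- **Cor. 4.2, mirror form**: `X₂` an abelian variety and `Hom_ℚ(X₁, X₂) = 0`.
[cite: Milne1999LefschetzClasses, §4 Cor. 4.2] -/
theorem IsAbelianVariety.divisorClasses_prod_eq_span_cross_of_homRat_eq_bot' {Φ₂ : (ι₂ → ℝ) ≃L[ℝ] E₂}
    (h₂ : IsAbelianVariety Φ₂) (h : homRat Φ₁ Φ₂ = ⊥) (p : ℕ) :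
    divisorClasses (prodPeriod Φ₁ Φ₂) p = Submodule.span ℚ {γ : (E₁ × E₂) [⋀^Fin (2 * p)]→L[ℝ] ℂ |
        ∃ (a b : ℕ) (h : 2 * a + 2 * b = 2 * p) (x : E₁ [⋀^Fin (2 * a)]→L[ℝ] ℂ)
          (y : E₂ [⋀^Fin (2 * b)]→L[ℝ] ℂ), x ∈ divisorClasses Φ₁ a ∧ y ∈ divisorClasses Φ₂ b ∧
          γ = ((x.compContinuousLinearMap (ContinuousLinearMap.fst ℝ E₁ E₂)).wedge
            (y.compContinuousLinearMap (ContinuousLinearMap.snd ℝ E₁ E₂))).domDomCongr (finCongr h)} :=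
  divisorClasses_prod_eq_span_cross Φ₁ Φ₂ (h₂.forall_apply_inl_inr_eq_zero_of_homRat_eq_bot' Φ₁ h) p

end Surjective

/-! ## §4 Proposition 4.1, injectivity: the cross products of independent families are independent -/

section Injective

variable {E₁ E₂ : Type*} [NormedAddCommGroup E₁] [NormedSpace ℂ E₁] [NormedAddCommGroup E₂]
  [NormedSpace ℂ E₂]

/-- **Gluing independent families along a system of projectors**: if `P_s` is the identity on the family
`v_s` and kills the families `v_t`, `t ≠ s`, and each `v_s` is linearly independent, then the total family
`(v_s)_s` is linearly independent (applied below to the Künneth projectors). [folklore] -/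
private theorem linearIndependent_sigma_of_proj {R M S : Type*} [Ring R] [AddCommGroup M] [Module R M]
    [Fintype S] [DecidableEq S] {κ : S → Type*} [∀ s, Fintype (κ s)] (v : (s : S) → κ s → M)
    (P : S → M →ₗ[R] M) (hv : ∀ s, LinearIndependent R (v s))
    (hP : ∀ (s t : S) (i : κ t), P s (v t i) = if t = s then v t i else 0) :
    LinearIndependent R fun q : (Σ s, κ s) ↦ v q.1 q.2 := by
  classical
  rw [Fintype.linearIndependent_iff]
  rintro g hg ⟨s, i⟩
  have hs : ∑ j, g ⟨s, j⟩ • v s j = 0 := by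
    have h := congrArg (P s) hg
    rw [map_zero, map_sum, Fintype.sum_sigma] at h
    rw [← h, eq_comm]
    refine (Fintype.sum_eq_single s fun t ht ↦ ?_).trans ?_
    · exact Finset.sum_eq_zero fun j _ ↦ by rw [map_smul, hP, if_neg ht, smul_zero]
    · exact Finset.sum_congr rfl fun j _ ↦ by rw [map_smul, hP, if_pos rfl]
  exact Fintype.linearIndependent_iff.1 (hv s) (fun j ↦ g ⟨s, j⟩) hs i

/-- **Künneth injectivity for cross products of families** (Voisin Thm. 11.38 / the injectivity half of
Prop. 4.1, valid for all forms and every pair of complex vector spaces): for `ℂ`-linearly independent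
`(x_i) ⊂ Λᵐ(E₁)`, `(y_j) ⊂ Λⁿ(E₂)` the cross products `p₁^*x_i ∧ p₂^*y_j` are `ℂ`-linearly independent.
[cite: Milne1999LefschetzClasses, §4 Prop. 4.1] [cite: Voisin2002, §11.3.3 Thm. 11.38] -/
theorem linearIndependent_cross {m n : ℕ} {κ₁ κ₂ : Type*} [Fintype κ₁] [Fintype κ₂]
    {x : κ₁ → E₁ [⋀^Fin m]→L[ℝ] ℂ} {y : κ₂ → E₂ [⋀^Fin n]→L[ℝ] ℂ} (hx : LinearIndependent ℂ x)
    (hy : LinearIndependent ℂ y) :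
    LinearIndependent ℂ fun ij : κ₁ × κ₂ ↦
      ((x ij.1).compContinuousLinearMap (ContinuousLinearMap.fst ℝ E₁ E₂)).wedge
        ((y ij.2).compContinuousLinearMap (ContinuousLinearMap.snd ℝ E₁ E₂)) := by
  rw [Fintype.linearIndependent_iff]
  rintro g hg ⟨i, j⟩
  -- regroup: `Σ_j p₁^*(Σ_i g_{ij} x_i) ∧ p₂^*y_j = 0`
  have hsum : ∑ j, ((∑ i, g (i, j) • x i).compContinuousLinearMap (ContinuousLinearMap.fst ℝ E₁ E₂)).wedge
      ((y j).compContinuousLinearMap (ContinuousLinearMap.snd ℝ E₁ E₂)) = 0 := by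
    rw [← hg, Fintype.sum_prod_type_right]
    refine Finset.sum_congr rfl fun j _ ↦ ?_
    have hlin : (∑ i, g (i, j) • x i).compContinuousLinearMap (ContinuousLinearMap.fst ℝ E₁ E₂) =
        ∑ i, g (i, j) • (x i).compContinuousLinearMap (ContinuousLinearMap.fst ℝ E₁ E₂) := by
      ext v
      simp only [ContinuousAlternatingMap.compContinuousLinearMap_apply, ContinuousAlternatingMap.sum_apply,
        ContinuousAlternatingMap.smul_apply]
    rw [hlin, sum_wedge_left]
    exact Finset.sum_congr rfl fun i _ ↦ by rw [wedge_smul_left_complex]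
  have hα := eq_zero_of_sum_wedge_comp_fst_snd_eq_zero (fun j ↦ ∑ i, g (i, j) • x i) hy hsum j
  exact Fintype.linearIndependent_iff.1 hx (fun i ↦ g (i, j)) hα i

/-- Künneth injectivity read in another degree (along `m + n = q`). [cite: Voisin2002, §11.3.3 Thm. 11.38] -/
theorem linearIndependent_cross_of_eq {m n q : ℕ} (h : m + n = q) {κ₁ κ₂ : Type*} [Fintype κ₁] [Fintype κ₂]
    {x : κ₁ → E₁ [⋀^Fin m]→L[ℝ] ℂ} {y : κ₂ → E₂ [⋀^Fin n]→L[ℝ] ℂ} (hx : LinearIndependent ℂ x)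
    (hy : LinearIndependent ℂ y) :
    LinearIndependent ℂ fun ij : κ₁ × κ₂ ↦
      (((x ij.1).compContinuousLinearMap (ContinuousLinearMap.fst ℝ E₁ E₂)).wedge
        ((y ij.2).compContinuousLinearMap (ContinuousLinearMap.snd ℝ E₁ E₂))).domDomCongr (finCongr h) := by
  subst h
  exact linearIndependent_cross hx hy

/-- A point `(a, b)` of the antidiagonal of `p` gives the degree equation `2a + 2b = 2p`. [folklore] -/
private theorem two_mul_add_two_mul_of_mem_antidiagonal {p : ℕ} (ab : ↥(antidiagonal p)) :
    2 * ab.1.1 + 2 * ab.1.2 = 2 * p := by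
  have := mem_antidiagonal.1 ab.2
  omega

/-- **All splittings at once**: for every `(a, b)` with `a + b = p` let `(x^{ab}_i)`, `(y^{ab}_j)` be
`ℂ`-linearly independent families of forms of degrees `2a` on `E₁` and `2b` on `E₂`; then the whole family
of cross products `p₁^*x^{ab}_i ∧ p₂^*y^{ab}_j`, read in degree `2p`, is `ℂ`-linearly independent — the
pieces of different splittings are separated by the Künneth projectors `K_{2b}` (row A4-43), each piece is
`linearIndependent_cross`. This is the injectivity of `⊕_{a+b=p} Hᵃ ⊗ Hᵇ → Hᵖ(X₁ × X₂)` of Prop. 4.1 /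
Thm. 11.38. [cite: Milne1999LefschetzClasses, §4 Prop. 4.1] [cite: Voisin2002, §11.3.3 Thm. 11.38] -/
theorem linearIndependent_cross_sigma (p : ℕ) {κ₁ κ₂ : ↥(antidiagonal p) → Type*}
    [∀ ab, Fintype (κ₁ ab)] [∀ ab, Fintype (κ₂ ab)]
    (x : (ab : ↥(antidiagonal p)) → κ₁ ab → E₁ [⋀^Fin (2 * ab.1.1)]→L[ℝ] ℂ)
    (y : (ab : ↥(antidiagonal p)) → κ₂ ab → E₂ [⋀^Fin (2 * ab.1.2)]→L[ℝ] ℂ)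
    (hx : ∀ ab, LinearIndependent ℂ (x ab)) (hy : ∀ ab, LinearIndependent ℂ (y ab)) :
    LinearIndependent ℂ fun q : (Σ ab : ↥(antidiagonal p), κ₁ ab × κ₂ ab) ↦
      (((x q.1 q.2.1).compContinuousLinearMap (ContinuousLinearMap.fst ℝ E₁ E₂)).wedge
        ((y q.1 q.2.2).compContinuousLinearMap (ContinuousLinearMap.snd ℝ E₁ E₂))).domDomCongr
          (finCongr (two_mul_add_two_mul_of_mem_antidiagonal q.1)) := by
  classical
  refine linearIndependent_sigma_of_proj
    (fun (ab : ↥(antidiagonal p)) (ij : κ₁ ab × κ₂ ab) ↦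
      (((x ab ij.1).compContinuousLinearMap (ContinuousLinearMap.fst ℝ E₁ E₂)).wedge
        ((y ab ij.2).compContinuousLinearMap (ContinuousLinearMap.snd ℝ E₁ E₂))).domDomCongr
          (finCongr (two_mul_add_two_mul_of_mem_antidiagonal ab)))
    (fun ab ↦ kunnethComponentₗ (2 * p) (2 * ab.1.2))
    (fun ab ↦ linearIndependent_cross_of_eq _ (hx ab) (hy ab)) fun ab ab' ij ↦ ?_
  rw [kunnethComponentₗ_apply, kunnethComponent_domDomCongr_finCongr, kunnethComponent_wedge_comp_fst_snd]
  by_cases hab : ab' = ab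
  · subst hab
    rw [if_pos rfl, if_pos rfl]
  · have hne : 2 * ab.1.2 ≠ 2 * ab'.1.2 := by
      intro h
      apply hab
      have h₁ := mem_antidiagonal.1 ab.2
      have h₂ := mem_antidiagonal.1 ab'.2
      exact Subtype.ext (Prod.ext (by omega) (by omega))
    rw [if_neg hne, if_neg hab, ContinuousAlternatingMap.domDomCongr_zero]

end Injective

/-! ## §4 (continued) The dimension count: `dim Dᵖ(X₁ × X₂) = Σ_{a+b=p} dim Dᵃ(X₁) · dim Dᵇ(X₂)` -/

section Dimension

variable {ι₁ ι₂ : Type*} [Fintype ι₁] [Fintype ι₂] [DecidableEq ι₁] [DecidableEq ι₂] {E₁ E₂ : Type*}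
  [NormedAddCommGroup E₁] [NormedSpace ℂ E₁] [NormedAddCommGroup E₂] [NormedSpace ℂ E₂]
  (Φ₁ : (ι₁ → ℝ) ≃L[ℝ] E₁) (Φ₂ : (ι₂ → ℝ) ≃L[ℝ] E₂)

omit [Fintype ι₁] [DecidableEq ι₁] in
/-- `Dᵖ(X) ⊆ H^{2p}(X, ℚ)`. [cite: Lange2023AbelianVarietiesComplex, §7.3.1] -/
theorem divisorClasses_le_rationalForms (p : ℕ) : divisorClasses Φ₁ p ≤ rationalForms Φ₁ (2 * p) :=
  (divisorClasses_le_hodgeClasses Φ₁ p).trans (hodgeClasses_le_rationalForms Φ₁ p)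

omit [DecidableEq ι₁] in
/-- `Dᵖ(X)` is finite-dimensional over `ℚ`. [cite: Lange2023AbelianVarietiesComplex, §7.3.1] -/
theorem finiteDimensional_divisorClasses (p : ℕ) : FiniteDimensional ℚ (divisorClasses Φ₁ p) :=
  finiteDimensional_of_le_rationalForms Φ₁ (divisorClasses_le_rationalForms Φ₁ p)

omit [DecidableEq ι₁] in
/-- **A `ℚ`-subspace `W ⊆ Hᵏ(X, ℚ)` has a finite `ℚ`-basis, and it is `ℂ`-linearly independent in
`Hᵏ(X, ℂ)`** (rational classes are a `ℚ`-structure: `linearIndependent_complex_of_mem_rationalForms`).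
[cite: Lange2023AbelianVarietiesComplex, §1.1.3 Cor. 1.1.19] -/
theorem exists_basis_linearIndependent_complex {k : ℕ} {W : Submodule ℚ (E₁ [⋀^Fin k]→L[ℝ] ℂ)}
    (hW : W ≤ rationalForms Φ₁ k) :
    ∃ b : Module.Basis (Fin (finrank ℚ W)) ℚ W, LinearIndependent ℂ fun i ↦ ((b i : W) : E₁ [⋀^Fin k]→L[ℝ] ℂ) := by
  haveI := finiteDimensional_of_le_rationalForms Φ₁ hW
  haveI : Module.Free ℚ W := Module.Free.of_divisionRing ℚ W
  set bW := Module.finBasis ℚ W with hbW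
  clear_value bW
  refine ⟨bW, ?_⟩
  set u : Fin (finrank ℚ W) → E₁ [⋀^Fin k]→L[ℝ] ℂ := fun i ↦ (bW i : E₁ [⋀^Fin k]→L[ℝ] ℂ) with hu
  have hQ : LinearIndependent ℚ u :=
    bW.linearIndependent.map_injOn W.subtype W.injective_subtype.injOn
  exact linearIndependent_complex_of_mem_rationalForms Φ₁ (v := u) (fun i ↦ hW (bW i).2) hQ

/-- **The cross-product bases**: the cross products of `ℚ`-bases of the `Dᵃ(X₁)`, `Dᵇ(X₂)` (`a + b = p`)
form a `ℚ`-linearly independent family of `Σ_{a+b=p} dim Dᵃ(X₁) · dim Dᵇ(X₂)` Lefschetz classes of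
`X₁ × X₂` whose span contains every cross product `p₁^*x ∧ p₂^*y`, `x ∈ Dᵃ(X₁)`, `y ∈ Dᵇ(X₂)`.
[cite: Milne1999LefschetzClasses, §4 Prop. 4.1] -/
theorem exists_linearIndependent_cross_family (p : ℕ) :
    ∃ (N : Type) (_ : Fintype N) (v : N → (E₁ × E₂) [⋀^Fin (2 * p)]→L[ℝ] ℂ),
      Fintype.card N = ∑ ab ∈ antidiagonal p,
          finrank ℚ (divisorClasses Φ₁ ab.1) * finrank ℚ (divisorClasses Φ₂ ab.2) ∧
        LinearIndependent ℚ v ∧ (∀ n, v n ∈ divisorClasses (prodPeriod Φ₁ Φ₂) p) ∧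
        Submodule.span ℚ {γ : (E₁ × E₂) [⋀^Fin (2 * p)]→L[ℝ] ℂ |
            ∃ (a b : ℕ) (h : 2 * a + 2 * b = 2 * p) (x : E₁ [⋀^Fin (2 * a)]→L[ℝ] ℂ)
              (y : E₂ [⋀^Fin (2 * b)]→L[ℝ] ℂ), x ∈ divisorClasses Φ₁ a ∧ y ∈ divisorClasses Φ₂ b ∧
              γ = ((x.compContinuousLinearMap (ContinuousLinearMap.fst ℝ E₁ E₂)).wedge
                (y.compContinuousLinearMap (ContinuousLinearMap.snd ℝ E₁ E₂))).domDomCongr (finCongr h)} ≤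
          Submodule.span ℚ (Set.range v) := by
  classical
  -- `ℚ`-bases of the factors' Lefschetz classes, splitting by splitting
  choose B₁ hB₁ using fun ab : ↥(antidiagonal p) ↦
    exists_basis_linearIndependent_complex Φ₁ (divisorClasses_le_rationalForms Φ₁ ab.1.1)
  choose B₂ hB₂ using fun ab : ↥(antidiagonal p) ↦
    exists_basis_linearIndependent_complex Φ₂ (divisorClasses_le_rationalForms Φ₂ ab.1.2)
  let v : (Σ ab : ↥(antidiagonal p), Fin (finrank ℚ (divisorClasses Φ₁ ab.1.1)) ×
      Fin (finrank ℚ (divisorClasses Φ₂ ab.1.2))) → (E₁ × E₂) [⋀^Fin (2 * p)]→L[ℝ] ℂ :=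
    fun q ↦ ((((B₁ q.1 q.2.1 : divisorClasses Φ₁ q.1.1.1) : E₁ [⋀^Fin (2 * q.1.1.1)]→L[ℝ] ℂ).compContinuousLinearMap
        (ContinuousLinearMap.fst ℝ E₁ E₂)).wedge
      (((B₂ q.1 q.2.2 : divisorClasses Φ₂ q.1.1.2) : E₂ [⋀^Fin (2 * q.1.1.2)]→L[ℝ] ℂ).compContinuousLinearMap
        (ContinuousLinearMap.snd ℝ E₁ E₂))).domDomCongr (finCongr (two_mul_add_two_mul_of_mem_antidiagonal q.1))
  refine ⟨_, inferInstance, v, ?_, ?_, ?_, ?_⟩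
  · rw [Fintype.card_sigma, ← Finset.sum_coe_sort (antidiagonal p)]
    exact Finset.sum_congr rfl fun ab _ ↦ by rw [Fintype.card_prod, Fintype.card_fin, Fintype.card_fin]
  · -- independent over `ℂ` (Künneth), hence over `ℚ`
    have hC : LinearIndependent ℂ v :=
      linearIndependent_cross_sigma (E₁ := E₁) (E₂ := E₂)
        (κ₁ := fun ab : ↥(antidiagonal p) ↦ Fin (finrank ℚ (divisorClasses Φ₁ ab.1.1)))
        (κ₂ := fun ab : ↥(antidiagonal p) ↦ Fin (finrank ℚ (divisorClasses Φ₂ ab.1.2))) p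
        (fun ab i ↦ ((B₁ ab i : divisorClasses Φ₁ ab.1.1) : E₁ [⋀^Fin (2 * ab.1.1)]→L[ℝ] ℂ))
        (fun ab j ↦ ((B₂ ab j : divisorClasses Φ₂ ab.1.2) : E₂ [⋀^Fin (2 * ab.1.2)]→L[ℝ] ℂ)) hB₁ hB₂
    exact hC.restrict_scalars fun a b hab ↦ Rat.cast_injective (α := ℂ)
      (by simpa only [Rat.smul_one_eq_cast] using hab)
  · intro q
    exact cross_mem_divisorClasses_of_eq Φ₁ Φ₂ _ (B₁ q.1 q.2.1).2 (B₂ q.1 q.2.2).2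
  · refine Submodule.span_le.2 ?_
    rintro _ ⟨a, b, h, x, y, hx, hy, rfl⟩
    have hab : (a, b) ∈ antidiagonal p := mem_antidiagonal.2 (by omega)
    -- expand `x`, `y` in the bases and the cross product bilinearly
    set ab : ↥(antidiagonal p) := ⟨(a, b), hab⟩ with hab_def
    -- the cross product as a `ℚ`-bilinear map
    let C : (E₁ [⋀^Fin (2 * a)]→L[ℝ] ℂ) →ₗ[ℚ] (E₂ [⋀^Fin (2 * b)]→L[ℝ] ℂ) →ₗ[ℚ]
        ((E₁ × E₂) [⋀^Fin (2 * p)]→L[ℝ] ℂ) :=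
      LinearMap.mk₂ ℚ (fun x y ↦ ((x.compContinuousLinearMap (ContinuousLinearMap.fst ℝ E₁ E₂)).wedge
          (y.compContinuousLinearMap (ContinuousLinearMap.snd ℝ E₁ E₂))).domDomCongr (finCongr h))
        (fun x x' y ↦ by
          simp only [add_compContinuousLinearMap_complex, ContinuousAlternatingMap.wedge_add_left,
            ContinuousAlternatingMap.domDomCongr_add])
        (fun c x y ↦ by
          simp only [← Rat.cast_smul_eq_qsmul ℂ c, smul_compContinuousLinearMap_complex, wedge_smul_left_complex,
            domDomCongr_complex_smul])
        (fun x y y' ↦ by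
          simp only [add_compContinuousLinearMap_complex, ContinuousAlternatingMap.wedge_add_right,
            ContinuousAlternatingMap.domDomCongr_add])
        (fun c x y ↦ by
          simp only [← Rat.cast_smul_eq_qsmul ℂ c, smul_compContinuousLinearMap_complex, wedge_smul_right_complex,
            domDomCongr_complex_smul])
    have hC : ∀ x y, C x y = ((x.compContinuousLinearMap (ContinuousLinearMap.fst ℝ E₁ E₂)).wedge
        (y.compContinuousLinearMap (ContinuousLinearMap.snd ℝ E₁ E₂))).domDomCongr (finCongr h) :=
      fun _ _ ↦ rfl
    have hxB : x = ∑ i, (B₁ ab).repr ⟨x, hx⟩ i • ((B₁ ab i : divisorClasses Φ₁ a) : E₁ [⋀^Fin (2 * a)]→L[ℝ] ℂ) := by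
      conv_lhs => rw [show x = ((⟨x, hx⟩ : divisorClasses Φ₁ a) : E₁ [⋀^Fin (2 * a)]→L[ℝ] ℂ) from rfl,
        ← (B₁ ab).sum_repr ⟨x, hx⟩]
      rw [Submodule.coe_sum]
      rfl
    have hyB : y = ∑ j, (B₂ ab).repr ⟨y, hy⟩ j • ((B₂ ab j : divisorClasses Φ₂ b) : E₂ [⋀^Fin (2 * b)]→L[ℝ] ℂ) := by
      conv_lhs => rw [show y = ((⟨y, hy⟩ : divisorClasses Φ₂ b) : E₂ [⋀^Fin (2 * b)]→L[ℝ] ℂ) from rfl,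
        ← (B₂ ab).sum_repr ⟨y, hy⟩]
      rw [Submodule.coe_sum]
      rfl
    rw [← hC, hxB, hyB]
    simp only [map_sum, map_smul, LinearMap.sum_apply, LinearMap.smul_apply, Finset.smul_sum]
    exact Submodule.sum_mem _ fun j _ ↦ Submodule.sum_mem _ fun i _ ↦
      Submodule.smul_mem _ _ (Submodule.smul_mem _ _ (Submodule.subset_span ⟨⟨ab, i, j⟩, rfl⟩))

/-- **`Σ_{a+b=p} dim_ℚ Dᵃ(X₁) · dim_ℚ Dᵇ(X₂) ≤ dim_ℚ Dᵖ(X₁ × X₂)` for EVERY pair of complex tori**: the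
map `x ⊗ y ↦ p₁^*x ∧ p₂^*y` of Prop. 4.1 is always injective (Künneth).
[cite: Milne1999LefschetzClasses, §4 Prop. 4.1] -/
theorem sum_finrank_divisorClasses_mul_le (p : ℕ) :
    ∑ ab ∈ antidiagonal p, finrank ℚ (divisorClasses Φ₁ ab.1) * finrank ℚ (divisorClasses Φ₂ ab.2) ≤
      finrank ℚ (divisorClasses (prodPeriod Φ₁ Φ₂) p) := by
  haveI := finiteDimensional_divisorClasses (prodPeriod Φ₁ Φ₂) p
  obtain ⟨N, _, v, hcard, hv, hmem, -⟩ := exists_linearIndependent_cross_family Φ₁ Φ₂ p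
  rw [← hcard, ← finrank_span_eq_card hv]
  exact Submodule.finrank_mono (Submodule.span_le.2 (Set.range_subset_iff.2 hmem))

/-- **PROPOSITION 4.1 (Milne 1999), the isomorphism, at torus level**: if `DC(X₁, X₂) ⊗ ℚ = 0` then
`dim_ℚ Dᵖ(X₁ × X₂) = Σ_{a+b=p} dim_ℚ Dᵃ(X₁) · dim_ℚ Dᵇ(X₂)` for every `p` — together with
`divisorClasses_prod_eq_span_cross` (onto) and `linearIndependent_cross_sigma` (one-to-one): the map
`x ⊗ y ↦ p₁^*x ∧ p₂^*y : ⊕_{a+b=p} Dᵃ(X₁) ⊗_ℚ Dᵇ(X₂) → Dᵖ(X₁ × X₂)` is an isomorphism, i.e.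
`D•(X₁) ⊗ D•(X₂) ≅ D•(X₁ × X₂)`. [cite: Milne1999LefschetzClasses, §4 Prop. 4.1] -/
theorem finrank_divisorClasses_prod_eq_sum
    (hDC : ∀ η : (E₁ × E₂) [⋀^Fin 2]→L[ℝ] ℝ, IsNSForm (prodPeriod Φ₁ Φ₂) η →
      ∀ (u : E₁) (w : E₂), η ![(u, 0), (0, w)] = 0) (p : ℕ) :
    finrank ℚ (divisorClasses (prodPeriod Φ₁ Φ₂) p) =
      ∑ ab ∈ antidiagonal p, finrank ℚ (divisorClasses Φ₁ ab.1) * finrank ℚ (divisorClasses Φ₂ ab.2) := by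
  obtain ⟨N, _, v, hcard, hv, hmem, hspan⟩ := exists_linearIndependent_cross_family Φ₁ Φ₂ p
  have heq : divisorClasses (prodPeriod Φ₁ Φ₂) p = Submodule.span ℚ (Set.range v) :=
    le_antisymm ((divisorClasses_prod_eq_span_cross Φ₁ Φ₂ hDC p).le.trans hspan)
      (Submodule.span_le.2 (Set.range_subset_iff.2 hmem))
  rw [heq, finrank_span_eq_card hv, hcard]

/-- **Prop. 4.1 dimension count with the hypothesis `nsCross Φ₁ Φ₂ = ⊥`.** [cite: Milne1999LefschetzClasses, §4 Prop. 4.1] -/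
theorem finrank_divisorClasses_prod_eq_sum_of_nsCross_eq_bot (h : nsCross Φ₁ Φ₂ = ⊥) (p : ℕ) :
    finrank ℚ (divisorClasses (prodPeriod Φ₁ Φ₂) p) =
      ∑ ab ∈ antidiagonal p, finrank ℚ (divisorClasses Φ₁ ab.1) * finrank ℚ (divisorClasses Φ₂ ab.2) :=
  finrank_divisorClasses_prod_eq_sum Φ₁ Φ₂ ((forall_apply_inl_inr_eq_zero_iff_nsCross_eq_bot Φ₁ Φ₂).2 h) p

/-- **Prop. 4.1 dimension count with the hypothesis `Hom_ℚ(X₂, X̂₁) = 0`.**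
[cite: Milne1999LefschetzClasses, §4 Prop. 4.1 and Cor. 4.2 (proof)] -/
theorem finrank_divisorClasses_prod_eq_sum_of_homRat_dualPeriod_eq_bot (h : homRat Φ₂ (dualPeriod Φ₁) = ⊥)
    (p : ℕ) :
    finrank ℚ (divisorClasses (prodPeriod Φ₁ Φ₂) p) =
      ∑ ab ∈ antidiagonal p, finrank ℚ (divisorClasses Φ₁ ab.1) * finrank ℚ (divisorClasses Φ₂ ab.2) :=
  finrank_divisorClasses_prod_eq_sum Φ₁ Φ₂ (forall_apply_inl_inr_eq_zero_of_homRat_dualPeriod_eq_bot Φ₁ Φ₂ h) p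

/-- **COROLLARY 4.2 (Milne 1999), dimension form**: for an abelian variety `X₁` and a complex torus `X₂`
with `Hom_ℚ(X₂, X₁) = 0`, `dim_ℚ Dᵖ(X₁ × X₂) = Σ_{a+b=p} dim_ℚ Dᵃ(X₁) · dim_ℚ Dᵇ(X₂)`
(`D(A)_k ⊗ D(B)_k ≅ D(A × B)_k`). [cite: Milne1999LefschetzClasses, §4 Cor. 4.2] -/
theorem IsAbelianVariety.finrank_divisorClasses_prod_eq_sum_of_homRat_eq_bot {Φ₁ : (ι₁ → ℝ) ≃L[ℝ] E₁}
    (h₁ : IsAbelianVariety Φ₁) (h : homRat Φ₂ Φ₁ = ⊥) (p : ℕ) :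
    finrank ℚ (divisorClasses (prodPeriod Φ₁ Φ₂) p) =
      ∑ ab ∈ antidiagonal p, finrank ℚ (divisorClasses Φ₁ ab.1) * finrank ℚ (divisorClasses Φ₂ ab.2) :=
  finrank_divisorClasses_prod_eq_sum Φ₁ Φ₂ (h₁.forall_apply_inl_inr_eq_zero_of_homRat_eq_bot Φ₂ h) p

/-- **Cor. 4.2, dimension form, mirror**: `X₂` an abelian variety and `Hom_ℚ(X₁, X₂) = 0`.
[cite: Milne1999LefschetzClasses, §4 Cor. 4.2] -/
theorem IsAbelianVariety.finrank_divisorClasses_prod_eq_sum_of_homRat_eq_bot' {Φ₂ : (ι₂ → ℝ) ≃L[ℝ] E₂}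
    (h₂ : IsAbelianVariety Φ₂) (h : homRat Φ₁ Φ₂ = ⊥) (p : ℕ) :
    finrank ℚ (divisorClasses (prodPeriod Φ₁ Φ₂) p) =
      ∑ ab ∈ antidiagonal p, finrank ℚ (divisorClasses Φ₁ ab.1) * finrank ℚ (divisorClasses Φ₂ ab.2) :=
  finrank_divisorClasses_prod_eq_sum Φ₁ Φ₂ (h₂.forall_apply_inl_inr_eq_zero_of_homRat_eq_bot' Φ₁ h) p

end Dimension

/-! ## §5 Validation: two non-isogenous elliptic curves, `dim_ℚ D•(E_τ × E_{τ'}) = (1, 2, 1, 0, …)` -/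

section EllipticPair

variable {τ τ' : ℂ} (hτ : τ.im ≠ 0) (hτ' : τ'.im ≠ 0)

/-- **`DC(E_τ, E_{τ'}) ⊗ ℚ = 0` for a non-isogenous pair of elliptic curves** (`1, τ, τ', ττ'` linearly
independent over `ℚ`, i.e. `Hom(E_τ, E_{τ'}) = 0`, `hom_eq_zero_iff_linearIndependent`): every divisor class
of `E_τ × E_{τ'}` has vanishing mixed Künneth part (`apply_inl_inr_eq_zero_of_linearIndependent` of
`ComplexTorusHodgeClassesNonIsogenousPair`, read on `NS`). [cite: Milne1999LefschetzClasses, §4 Cor. 4.2 (proof: "`Hom(A, B) = 0` … then `DC(A, B) = 0`")] -/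
theorem forall_apply_inl_inr_eq_zero_ellipticPair (hli : LinearIndependent ℚ ![(1 : ℂ), τ, τ', τ * τ'])
    (η : (ℂ × ℂ) [⋀^Fin 2]→L[ℝ] ℝ) (hη : IsNSForm (prodPeriod (ellipticPeriod hτ) (ellipticPeriod hτ')) η)
    (u w : ℂ) : η ![(u, 0), (0, w)] = 0 := by
  have h := apply_inl_inr_eq_zero_of_linearIndependent hτ hτ' hli (ofRealForm_mem_hodgeClasses_one _ hη) u w
  rwa [ofRealForm_apply, Complex.ofReal_eq_zero] at h

/-- `dim_ℚ D⁰(X) = 1` (`D⁰ = ℚ · 1`). [cite: Lange2023AbelianVarietiesComplex, §7.3.1] -/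
theorem finrank_divisorClasses_zero {ι : Type*} {E : Type*} [NormedAddCommGroup E] [NormedSpace ℂ E]
    (Φ : (ι → ℝ) ≃L[ℝ] E) : finrank ℚ (divisorClasses Φ 0) = 1 := by
  rw [divisorClasses_zero, finrank_span_singleton]
  intro h
  have := congrArg (fun γ : E [⋀^Fin (2 * 0)]→L[ℝ] ℂ ↦ γ Fin.elim0) h
  simp at this

/-- `dim_ℚ D¹(E_τ) = 1` (`D¹ = H²_Hodge = H²(E_τ, ℚ)`). [cite: Lange2023AbelianVarietiesComplex, §7.3.3 Exercise (2)] -/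
theorem finrank_divisorClasses_ellipticPeriod_one : finrank ℚ (divisorClasses (ellipticPeriod hτ) 1) = 1 := by
  rw [divisorClasses_one_eq_hodgeClasses, finrank_hodgeClasses_ellipticPeriod_one]

/-- `Dᵃ(E_τ) = 0` for `a ≥ 2` (no forms of degree `2a > 2` on a curve). [cite: Lange2023AbelianVarietiesComplex, §1.1.3 Lemma 1.1.17] -/
theorem divisorClasses_ellipticPeriod_eq_bot {a : ℕ} (ha : 2 ≤ a) : divisorClasses (ellipticPeriod hτ) a = ⊥ := by
  refine (Submodule.eq_bot_iff _).2 fun γ _ ↦ ?_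
  exact eq_zero_of_card_lt (ellipticPeriod hτ) γ (by simp; omega)

/-- `dim_ℚ Dᵃ(E_τ) = 0` for `a ≥ 2`. [cite: Lange2023AbelianVarietiesComplex, §1.1.3 Lemma 1.1.17] -/
theorem finrank_divisorClasses_ellipticPeriod_eq_zero {a : ℕ} (ha : 2 ≤ a) :
    finrank ℚ (divisorClasses (ellipticPeriod hτ) a) = 0 := by
  rw [divisorClasses_ellipticPeriod_eq_bot hτ ha, finrank_bot]

/-- The `ℚ`-dimensions of `D•(E_τ)`: `(1, 1, 0, 0, …)`. [cite: Lange2023AbelianVarietiesComplex, §7.3.3 Exercise (2)] -/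
theorem finrank_divisorClasses_ellipticPeriod (a : ℕ) :
    finrank ℚ (divisorClasses (ellipticPeriod hτ) a) = if a ≤ 1 then 1 else 0 := by
  rcases Nat.lt_or_ge a 2 with h | h
  · rw [if_pos (by omega)]
    interval_cases a
    · exact finrank_divisorClasses_zero _
    · exact finrank_divisorClasses_ellipticPeriod_one hτ
  · rw [if_neg (by omega)]
    exact finrank_divisorClasses_ellipticPeriod_eq_zero hτ h

/-- **VALIDATION of Prop. 4.1 on a non-isogenous pair of elliptic curves**:
`dim_ℚ Dᵖ(E_τ × E_{τ'}) = Σ_{a+b=p} dim Dᵃ(E_τ) · dim Dᵇ(E_{τ'}) = C(2, p) = (1, 2, 1, 0, …)` — in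
particular `ρ(E_τ × E_{τ'}) = dim D¹ = 2` (the classes of `E_τ × pt` and `pt × E_{τ'}`, cf.
`finrank_hodgeClasses_ellipticPair_of_linearIndependent`) and `D²` is the line of the point class.
[cite: Milne1999LefschetzClasses, §4 Prop. 4.1 and Cor. 4.2] -/
theorem finrank_divisorClasses_ellipticPair (hli : LinearIndependent ℚ ![(1 : ℂ), τ, τ', τ * τ']) (p : ℕ) :
    finrank ℚ (divisorClasses (prodPeriod (ellipticPeriod hτ) (ellipticPeriod hτ')) p) = Nat.choose 2 p := by
  rw [finrank_divisorClasses_prod_eq_sum _ _ (forall_apply_inl_inr_eq_zero_ellipticPair hτ hτ' hli) p]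
  simp_rw [finrank_divisorClasses_ellipticPeriod]
  rcases Nat.lt_or_ge p 3 with h | h
  · interval_cases p <;> simp [Finset.Nat.antidiagonal_succ]
  · rw [Nat.choose_eq_zero_of_lt (by omega)]
    refine Finset.sum_eq_zero fun ab hab ↦ ?_
    have := mem_antidiagonal.1 hab
    split_ifs with h₁ h₂ <;> first | rfl | (exfalso; omega)

end EllipticPair

end ComplexTorus

end Literature.Geometry.Kaehler

end
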